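import Mathlib
import HarnessLib

/-!
# LOSS theorem N33∞ at `(1/5(1,2) × line)_Q` — ring-level foothold: the hypersurface `B = k[Y,u]/(u⁴Y)`, the
# exactness of its 2-periodic complex `… → B —Y→ B —u⁴→ B —Y→ B`, the loss witness `4u³ ≠ 0` on `k[u]/(u⁴)`, and the
# step-(0) identities of proof (B) under the toric relations of `1/5(1,2)`

[OURS · L1 w44b · crux `Persistence` stmt-ResolutionOfSingularities-16484 · helper, counted 0 · res-D-pv-026 on
res-plan-2 IDLE POOL DEAL #4c 2026-08-27T08:54:56Z «U3′ = the ring-level foothold»; AI-written, weaker than expert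
review; NOT a statement of the manuscript under study and no statement of that manuscript is used.]

The refereed memo theorem «`ab² ∉ caⁿ((1/5(1,2) × line)_Q)` for every `n`» (tri-2 `K-V8A-CERT.md` §6 = proof (B);
stub-2 `CERT-K-v8a.md` = proof (A); stub-3 Theorem L = proof (C); compiled in tri-2 `LOSS-THEOREM.md`) rests, in
proof (B), on three finite ring-level facts which this file certifies in the kernel (no `Ext`/`Tor` layer — those stay
memo-level until a computational homological layer exists):

* §1 `B = k[Y,u]/(u⁴·Y)`: `mul_Y_eq_zero_iff` (`f·Ȳ = 0 ↔ f ∈ (ū⁴)`) and `mul_u4_eq_zero_iff` (`f·ū⁴ = 0 ↔ f ∈ (Ȳ)`),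
  i.e. `ann_B(Y) = (u⁴)` and `ann_B(u⁴) = (Y)`: the 2-periodic complex `… → B —Y→ B —u⁴→ B —Y→ B → B/(Y) → 0`
  (the matrix factorisation `(Y)·(u⁴) = u⁴Y` of the NON-monic hypersurface) has `d² = 0` (`Y_mul_u4_eq_zero`) and
  is EXACT — for every field `k`, every characteristic;
* §2 the loss witness after base change to `Λ = B/(Y) = k[u]`: the induced maps are `0` and `·u⁴`, so the odd
  homology is `k[u]/(u⁴)` and the even homology vanishes (`ker (·u⁴) = 0` in the domain `k[u]`,
  `mul_X_pow_four_injective`); the element `z₂ = ab²` acts there as `4u³`, and `four_X_cube_not_mem_span_X_pow_four` :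
  `4u³ ∉ (u⁴)` when `(4 : k) ≠ 0` (char `k ≠ 2`), resp. `X_cube_not_mem_span_X_pow_four` : `u³ ∉ (u⁴)` always
  (the straight arc `c = 1` of `CERT-K-v8a`);
* §3 the step-(0) identities of proof (B) in ANY commutative ring with elements `x z₁ z₂ y u` satisfying the three
  quasi-determinantal relations of `V = 1/5(1,2)` (`z₁² = x z₂`, `z₂³ = z₁ y`, `z₁ z₂² = x y`; the 2×2 minors of
  `[[x, z₁, z₂²],[z₁, z₂, y]]`), with `ξ = z₂ − 4u³`, `η = z₁ + 2u⁴`, `X = x − u⁵`, `Y = y + 32u⁵` (the arc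
  `a = u, b = −2u`): `two_u4_Y` (`2u⁴Y = η·y − g·ξ`, `g = ξ² + 12u³ξ + 48u⁶`), `four_u3_X_mem` (`4u³X = η(η − 4u⁴) −
  ξ(X + u⁵)`), `u5_Y_mem` (`u⁵Y ∈ (ξ, η, X)`, explicit combination) — so that modulo `(ξ, η, X)` the images of `u⁴Y`
  (char ≠ 2) and `u⁵Y` vanish, as §6 (0) of the memo says. That `R/(ξ,η,X)` is EXACTLY `k[Y,u]/(u⁴Y)` (no further
  relations) is NOT claimed here.

References (mechanism only): J. Tate, Illinois J. Math. 1 (1957); T. Gulliksen, G. Levin, *Homology of local rings*,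
Queen's Papers 20 (1969); D. Eisenbud, Trans. AMS 260 (1980) (matrix factorisations).
-/

noncomputable section

-- single-problem summit: the doubled namespace component `ResolutionOfSingularities` is forced
set_option linter.dupNamespace false

namespace Summit.ResolutionOfSingularities.ResolutionOfSingularities.Theorems.HomologicalConductor.LossFoothold

universe u

/-! ## §1 The hypersurface `B = k[Y,u]/(u⁴Y)` and the exactness of its 2-periodic complex -/

section B

variable (k : Type u) [Field k]

/-- The polynomial ring `k[Y,u]`: `Y = X 0`, `u = X 1`. [OURS · L1 w44b] -/
abbrev P : Type u := MvPolynomial (Fin 2) k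

/-- The defining equation `u⁴·Y` of the hypersurface `B`. [OURS · L1 w44b] -/
def eqn : P k := MvPolynomial.X 1 ^ 4 * MvPolynomial.X 0

/-- The hypersurface ring `B = k[Y,u]/(u⁴·Y)` of proof (B) (tri-2 K-V8A-CERT §6: `B = R/(ξ,η,X)`). [OURS · L1 w44b] -/
abbrev B : Type u := P k ⧸ Ideal.span {eqn k}

/-- The class `Ȳ` of `Y` in `B`. [OURS · L1 w44b] -/
def Ybar : B k := Ideal.Quotient.mk _ (MvPolynomial.X 0)

/-- The class `ū` of `u` in `B`. [OURS · L1 w44b] -/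
def ubar : B k := Ideal.Quotient.mk _ (MvPolynomial.X 1)

/-- `d² = 0` for the 2-periodic complex: `Ȳ · ū⁴ = 0` in `B`. [OURS · L1 w44b] -/
theorem Y_mul_u4_eq_zero : Ybar k * ubar k ^ 4 = 0 := by
  rw [Ybar, ubar, ← map_pow, ← map_mul, Ideal.Quotient.eq_zero_iff_mem, Ideal.mem_span_singleton, eqn]
  exact ⟨1, by ring⟩

/-- `ū⁴ · Ȳ = 0` in `B`. [OURS · L1 w44b] -/
theorem u4_mul_Y_eq_zero : ubar k ^ 4 * Ybar k = 0 := by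
  rw [mul_comm, Y_mul_u4_eq_zero]

/-- **`ann_B(Y) = (u⁴)`**: for `f ∈ B`, `f · Ȳ = 0 ↔ f ∈ (ū⁴)` — exactness of the periodic complex at the `—u⁴→ B —Y→`
spots (unique factorisation in `k[Y,u]`: `F·Y = G·u⁴·Y ⇒ F = G·u⁴`). [OURS · L1 w44b] -/
theorem mul_Y_eq_zero_iff (f : B k) : f * Ybar k = 0 ↔ f ∈ Ideal.span {ubar k ^ 4} := by
  constructor
  · intro h
    obtain ⟨F, rfl⟩ := Ideal.Quotient.mk_surjective f
    rw [Ybar, ← map_mul, Ideal.Quotient.eq_zero_iff_mem, Ideal.mem_span_singleton] at h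
    obtain ⟨G, hG⟩ := h
    -- `F * Y = u⁴ * Y * G` in the domain `k[Y,u]`, cancel `Y`
    have hY : (MvPolynomial.X 0 : P k) ≠ 0 := MvPolynomial.X_ne_zero 0
    have hF : F = MvPolynomial.X 1 ^ 4 * G := by
      apply mul_right_cancel₀ hY
      rw [hG, eqn]; ring
    rw [hF, ubar, ← map_pow, Ideal.mem_span_singleton]
    exact ⟨Ideal.Quotient.mk _ G, by rw [← map_mul]⟩
  · intro h
    rw [Ideal.mem_span_singleton] at h
    obtain ⟨g, rfl⟩ := h
    rw [mul_assoc, mul_comm g, ← mul_assoc, u4_mul_Y_eq_zero, zero_mul]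

/-- **`ann_B(u⁴) = (Y)`**: for `f ∈ B`, `f · ū⁴ = 0 ↔ f ∈ (Ȳ)` — exactness at the `—Y→ B —u⁴→` spots
(`F·u⁴ = G·u⁴·Y ⇒ F = G·Y`). [OURS · L1 w44b] -/
theorem mul_u4_eq_zero_iff (f : B k) : f * ubar k ^ 4 = 0 ↔ f ∈ Ideal.span {Ybar k} := by
  constructor
  · intro h
    obtain ⟨F, rfl⟩ := Ideal.Quotient.mk_surjective f
    rw [ubar, ← map_pow, ← map_mul, Ideal.Quotient.eq_zero_iff_mem, Ideal.mem_span_singleton] at h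
    obtain ⟨G, hG⟩ := h
    have hu : (MvPolynomial.X 1 ^ 4 : P k) ≠ 0 := pow_ne_zero 4 (MvPolynomial.X_ne_zero 1)
    have hF : F = MvPolynomial.X 0 * G := by
      apply mul_right_cancel₀ hu
      rw [hG, eqn]; ring
    rw [hF, Ybar, Ideal.mem_span_singleton]
    exact ⟨Ideal.Quotient.mk _ G, by rw [← map_mul]⟩
  · intro h
    rw [Ideal.mem_span_singleton] at h
    obtain ⟨g, rfl⟩ := h
    rw [mul_assoc, mul_comm g, ← mul_assoc, Y_mul_u4_eq_zero, zero_mul]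

/-- Exactness in kernel/range form: `ker (·Ȳ) = range (·ū⁴)` as `B`-submodules of `B`. [OURS · L1 w44b] -/
theorem ker_mulY_eq_range_mulU4 :
    LinearMap.ker (LinearMap.mulRight (B k) (Ybar k)) = LinearMap.range (LinearMap.mulRight (B k) (ubar k ^ 4)) := by
  ext f
  rw [LinearMap.mem_ker, LinearMap.mulRight_apply, mul_Y_eq_zero_iff, Ideal.mem_span_singleton', LinearMap.mem_range]
  simp only [LinearMap.mulRight_apply]

/-- Exactness in kernel/range form: `ker (·ū⁴) = range (·Ȳ)` as `B`-submodules of `B`. [OURS · L1 w44b] -/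
theorem ker_mulU4_eq_range_mulY :
    LinearMap.ker (LinearMap.mulRight (B k) (ubar k ^ 4)) = LinearMap.range (LinearMap.mulRight (B k) (Ybar k)) := by
  ext f
  rw [LinearMap.mem_ker, LinearMap.mulRight_apply, mul_u4_eq_zero_iff, Ideal.mem_span_singleton', LinearMap.mem_range]
  simp only [LinearMap.mulRight_apply]

end B

/-! ## §2 The loss witness on `Λ = B/(Y) = k[u]`: odd homology `k[u]/(u⁴)`, even homology `0`, and `4u³ ≠ 0` there -/

section Lambda

variable (k : Type u) [Field k]

open Polynomial in
/-- **Even homology vanishes**: multiplication by `u⁴` on `Λ = k[u]` is injective (`k[u]` is a domain), so the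
base-changed periodic complex `… —0→ k[u] —u⁴→ k[u] —0→ k[u] —u⁴→ …` has `ker (·u⁴) = 0`. [OURS · L1 w44b] -/
theorem mul_X_pow_four_injective : Function.Injective fun f : k[X] => f * X ^ 4 :=
  mul_left_injective₀ (pow_ne_zero 4 X_ne_zero)

open Polynomial in
/-- **Odd homology is `k[u]/(u⁴)`**: at the spots `—0→ k[u] —u⁴→` the kernel of `0` is everything and the image of
`·u⁴` is the ideal `(u⁴)`, so the homology is `k[u] ⧸ (u⁴)`; recorded as the identification of the image.
[OURS · L1 w44b] -/
theorem range_mul_X_pow_four : Set.range (fun f : k[X] => f * X ^ 4) = (Ideal.span {(X ^ 4 : k[X])} : Set k[X]) := by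
  ext g
  simp only [Set.mem_range, SetLike.mem_coe, Ideal.mem_span_singleton']

open Polynomial in
/-- **The DIRT, straight arc (`c = 1`, every characteristic)**: `u³ ∉ (u⁴)` in `k[u]` — the class of `z₂ = ab² ↦ u³`
does not kill the generator of the odd homology `k[u]/(u⁴)`. [OURS · L1 w44b] -/
theorem X_cube_not_mem_span_X_pow_four : (X ^ 3 : k[X]) ∉ Ideal.span {(X ^ 4 : k[X])} := by
  intro h
  rw [Ideal.mem_span_singleton] at h
  have h1 := natDegree_le_of_dvd h (pow_ne_zero 3 X_ne_zero)
  rw [natDegree_X_pow, natDegree_X_pow] at h1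
  omega

open Polynomial in
/-- **The DIRT, tri-2's arc (`a = u`, `b = −2u`, char `k ≠ 2`)**: `4u³ ∉ (u⁴)` in `k[u]` when `(4 : k) ≠ 0` — `z₂ ↦ 4u³`
acts NON-trivially on `k[u]/(u⁴)` (K-V8A-CERT §6 (6): «on which `4u³ ≠ 0`»). [OURS · L1 w44b] -/
theorem four_X_cube_not_mem_span_X_pow_four (h4 : (4 : k) ≠ 0) :
    (C (4 : k) * X ^ 3 : k[X]) ∉ Ideal.span {(X ^ 4 : k[X])} := by
  intro h
  rw [Ideal.mem_span_singleton] at h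
  have hne : (C (4 : k) * X ^ 3 : k[X]) ≠ 0 :=
    mul_ne_zero (by rwa [Ne, Polynomial.C_eq_zero]) (pow_ne_zero 3 X_ne_zero)
  have h1 := natDegree_le_of_dvd h hne
  rw [natDegree_C_mul_X_pow 3 (4 : k) h4, natDegree_X_pow] at h1
  omega

open Polynomial in
/-- Hence the class of `4u³` in the odd homology `k[u] ⧸ (u⁴)` is non-zero (char `k ≠ 2`). [OURS · L1 w44b] -/
theorem mk_four_X_cube_ne_zero (h4 : (4 : k) ≠ 0) :
    Ideal.Quotient.mk (Ideal.span {(X ^ 4 : k[X])}) (C (4 : k) * X ^ 3) ≠ 0 := by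
  rw [Ne, Ideal.Quotient.eq_zero_iff_mem]
  exact four_X_cube_not_mem_span_X_pow_four k h4

end Lambda

/-! ## §3 Step (0) of proof (B): identities under the toric relations of `V = 1/5(1,2)` -/

section StepZero

variable {A : Type u} [CommRing A] (x z₁ z₂ y u : A)

/-- **(R2) `2u⁴·Y = η·y − g·ξ`** with `ξ = z₂ − 4u³`, `η = z₁ + 2u⁴`, `Y = y + 32u⁵`, `g = ξ² + 12u³ξ + 48u⁶`, in ANY commutative
ring in which the toric relation `z₂³ = z₁·y` of `1/5(1,2)` holds (K-V8A-CERT §6 (0)). [OURS · L1 w44b] -/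
theorem two_u4_Y (h2 : z₂ ^ 3 = z₁ * y) :
    2 * u ^ 4 * (y + 32 * u ^ 5) =
      (z₁ + 2 * u ^ 4) * y -
        ((z₂ - 4 * u ^ 3) ^ 2 + 12 * u ^ 3 * (z₂ - 4 * u ^ 3) + 48 * u ^ 6) * (z₂ - 4 * u ^ 3) := by
  linear_combination h2

/-- **(R1) `4u³·X = η(η − 4u⁴) − ξ(X + u⁵)`** with `X = x − u⁵`, from the toric relation `z₁² = x·z₂`; in particular
`4u³X ∈ (ξ, η)`. [OURS · L1 w44b] -/
theorem four_u3_X (h1 : z₁ ^ 2 = x * z₂) :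
    4 * u ^ 3 * (x - u ^ 5) =
      (z₁ + 2 * u ^ 4) * ((z₁ + 2 * u ^ 4) - 4 * u ^ 4) - (z₂ - 4 * u ^ 3) * ((x - u ^ 5) + u ^ 5) := by
  linear_combination (-1 : A) * h1

/-- **(R3) `u⁵·Y ∈ (ξ, η, X)`**, explicitly
`u⁵Y = η ξ² + 8u³ η ξ + 16u⁶ η − 2u⁴ ξ² − 16u⁷ ξ − X·Y + 32u⁵ X`, from the toric relation `z₁·z₂² = x·y`.
[OURS · L1 w44b] -/
theorem u5_Y (h3 : z₁ * z₂ ^ 2 = x * y) :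
    u ^ 5 * (y + 32 * u ^ 5) =
      (z₁ + 2 * u ^ 4) * (z₂ - 4 * u ^ 3) ^ 2 + 8 * u ^ 3 * (z₁ + 2 * u ^ 4) * (z₂ - 4 * u ^ 3) +
        16 * u ^ 6 * (z₁ + 2 * u ^ 4) - 2 * u ^ 4 * (z₂ - 4 * u ^ 3) ^ 2 - 16 * u ^ 7 * (z₂ - 4 * u ^ 3) -
        (x - u ^ 5) * (y + 32 * u ^ 5) + 32 * u ^ 5 * (x - u ^ 5) := by
  linear_combination (-1 : A) * h3

/-- Three-generator membership from an explicit combination. [OURS · L1 w44b] -/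
private theorem mem_span_triple_of_eq {a b c r s t w : A} (h : w = r * a + s * b + t * c) :
    w ∈ Ideal.span ({a, b, c} : Set A) := by
  rw [h]
  refine Ideal.add_mem _ (Ideal.add_mem _ (Ideal.mul_mem_left _ _ (Ideal.subset_span (by simp)))
    (Ideal.mul_mem_left _ _ (Ideal.subset_span (by simp)))) (Ideal.mul_mem_left _ _ (Ideal.subset_span (by simp)))

/-- Two-generator membership from an explicit combination. [OURS · L1 w44b] -/
private theorem mem_span_pair_of_eq {a b r s w : A} (h : w = r * a + s * b) : w ∈ Ideal.span ({a, b} : Set A) := by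
  rw [h]
  exact Ideal.add_mem _ (Ideal.mul_mem_left _ _ (Ideal.subset_span (by simp)))
    (Ideal.mul_mem_left _ _ (Ideal.subset_span (by simp)))

/-- Membership form of (R1): `4u³·X ∈ (ξ, η)`. [OURS · L1 w44b] -/
theorem four_u3_X_mem (h1 : z₁ ^ 2 = x * z₂) :
    4 * u ^ 3 * (x - u ^ 5) ∈ Ideal.span ({z₂ - 4 * u ^ 3, z₁ + 2 * u ^ 4} : Set A) :=
  mem_span_pair_of_eq (r := -((x - u ^ 5) + u ^ 5)) (s := (z₁ + 2 * u ^ 4) - 4 * u ^ 4)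
    (by linear_combination (-1 : A) * h1)

/-- Membership form of (R2): `2u⁴·Y ∈ (ξ, η)` (so `2u⁴Y = 0` modulo `(ξ, η, X)`; with (R3), `u⁴Y = 0` there whenever `2`
is invertible — the defining relation of `B = k[Y,u]/(u⁴Y)`). [OURS · L1 w44b] -/
theorem two_u4_Y_mem (h2 : z₂ ^ 3 = z₁ * y) :
    2 * u ^ 4 * (y + 32 * u ^ 5) ∈ Ideal.span ({z₂ - 4 * u ^ 3, z₁ + 2 * u ^ 4} : Set A) :=
  mem_span_pair_of_eq (r := -((z₂ - 4 * u ^ 3) ^ 2 + 12 * u ^ 3 * (z₂ - 4 * u ^ 3) + 48 * u ^ 6)) (s := y)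
    (by linear_combination h2)

/-- Membership form of (R3): `u⁵·Y ∈ (ξ, η, X)`, with the explicit combination
`u⁵Y = (−2u⁴ξ − 16u⁷)·ξ + (ξ² + 8u³ξ + 16u⁶)·η + (−y)·X`. [OURS · L1 w44b] -/
theorem u5_Y_mem (h3 : z₁ * z₂ ^ 2 = x * y) :
    u ^ 5 * (y + 32 * u ^ 5) ∈ Ideal.span ({z₂ - 4 * u ^ 3, z₁ + 2 * u ^ 4, x - u ^ 5} : Set A) :=
  mem_span_triple_of_eq (r := -2 * u ^ 4 * (z₂ - 4 * u ^ 3) - 16 * u ^ 7)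
    (s := (z₂ - 4 * u ^ 3) ^ 2 + 8 * u ^ 3 * (z₂ - 4 * u ^ 3) + 16 * u ^ 6) (t := -y)
    (by linear_combination (-1 : A) * h3)

/-- **Consequently, modulo `(ξ, η, X)` both `2u⁴Y` and `u⁵Y` vanish**: for the quotient map `π : A → A/(ξ,η,X)`,
`π(2u⁴Y) = 0` and `π(u⁵Y) = 0` — the two relations from which tri-2 reads `B = R/(ξ,η,X) = k[Y,u]/(u⁴Y)` (char ≠ 2).
[OURS · L1 w44b] -/
theorem mk_two_u4_Y_eq_zero_and_mk_u5_Y_eq_zero (h2 : z₂ ^ 3 = z₁ * y) (h3 : z₁ * z₂ ^ 2 = x * y) :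
    Ideal.Quotient.mk (Ideal.span ({z₂ - 4 * u ^ 3, z₁ + 2 * u ^ 4, x - u ^ 5} : Set A)) (2 * u ^ 4 * (y + 32 * u ^ 5)) = 0 ∧
    Ideal.Quotient.mk (Ideal.span ({z₂ - 4 * u ^ 3, z₁ + 2 * u ^ 4, x - u ^ 5} : Set A)) (u ^ 5 * (y + 32 * u ^ 5)) = 0 := by
  refine ⟨?_, ?_⟩
  · rw [Ideal.Quotient.eq_zero_iff_mem]
    refine Ideal.span_mono ?_ (two_u4_Y_mem z₁ z₂ y u h2)
    intro w hw
    simp only [Set.mem_insert_iff, Set.mem_singleton_iff] at hw ⊢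
    tauto
  · rw [Ideal.Quotient.eq_zero_iff_mem]
    exact u5_Y_mem x z₁ z₂ y u h3

end StepZero

end Summit.ResolutionOfSingularities.ResolutionOfSingularities.Theorems.HomologicalConductor.LossFoothold

end
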